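import Summits.CriticalPhenomena.PercolationContinuityZ3.Theorems.PercNearOneGluingNoHeavyLowerTailQ7PsiSetObserverHalf
import HarnessLib

/-!
# `NoHeavyLowerTail` (stmt-CriticalPhenomena-4575) — (GΨ₃) for a SET of observers from the set-observer marker
# dominance lemma (Kozma–Nitzan Question 9 at `|A| = 3` reduced to one atom)

Support file (`--supports stmt-CriticalPhenomena-4575`), coupling seat `prim-cplus-coupling` (gen 13).  No
definitions, no named facts, no sorries.  Memo A5-COUPLING-gen13.md §5 (assembly of B5 `…SetObserverHalf` and B6
`…SetObserverDom`).

* `Q7Psi.gpsi_three_set_of_setMDL` — for an observer SET `N`, strong relays `x, y`, weak relay `z` (distinct) with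
  `μ(x↮y, x↮z) > 0`, `μ(y↮x, y↮z) > 0`: IF the set-observer marker dominance lemma holds on both sides, i.e. for every
  monotone `G`
  `μ(W2) · cov_{x↮z}(G(C_x), {x↔y}) ≤ μ(E2) · cov_{x↮z}(G(C_x), {x↔N, z↮N})` and symmetrically in `(y, x)`
  (`cov_D` denominator-free, `W2 = {y↔N, x↮N, z↮N}`, `E2 = {y↮x, y↮z}`), THEN (GΨ₃-set) holds for every monotone `F`:
  `E F(C_z) ≤ E F(C_x), E F(C_y)` ⟹ `∫_{x↔N ∪ y↔N} F(C_z) ≤ ∫_{x↔N ∪ y↔N} F(C_N)`, `C_N = ⋃_{n∈N} C_n`.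
The split is the census point `t* = a μ(E2) / (a μ(E2) + b μ(E1))` (`a = μ(W1)`, `b = μ(W2)`), the multipliers
`λ* μ(x↮z) = (1−t*) a + t* μ(x↔N, z↮N) = a + t*(d+e)`, `μ* μ(y↮z) = b + (1−t*)(d+e)` — exactly the closed form found by
the seat's census (memo §2: 0 failures in 3,100 exact instances).  For `N = {o}` the hypothesis is the tree theorem
`CovTau.covTau` and the conclusion is `Q7Psi.gpsi_three`; for a set it is the conjectured atom MDL-set (memo §3.3, §4:
pencil proof along prim-hp-7's `T_A` induction; exact census 0 / 4,600; `z`-free case `Q7Psi.setObs_cov_ge`).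
[cite: KozmaNitzan2024, §5.1 (pp. 31–32), Question 9 (p. 36)] [cite: VandenbergHaggstromKahn2005, Thms 1.3–1.5 (pp. 6–8)]
-/

namespace Summit.CriticalPhenomena.PercolationContinuityZ3.Theorems

open MeasureTheory Set Literature.Probability.LatticeModels Literature.Probability.Percolation
open scoped Classical
open KNPreFKG

noncomputable section

namespace Q7Psi

variable {V : Type*} [Fintype V]

/-- **(GΨ₃) for a set of observers, modulo the set-observer marker dominance lemma** (see the file header for the
statement and the notation; the lemma is required for every monotone real function of the vertex cluster, on the
`x`-side and on the `y`-side).  Proof: `hx_set_of_setMDL` on both sides at the complementary splits `t*` and `1 − t*`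
(the two census relations `t*(a e2 + b e1) = a e2` and `(1−t*)(b e1 + a e2) = b e1` coincide), then
`gpsi_three_set_of_halves`; a monotone `F` is first shifted to `F − F(∅) ≥ 0`.
[cite: KozmaNitzan2024, §5.1 (pp. 31–32), Question 9 (p. 36)] -/
theorem gpsi_three_set_of_setMDL (w : Sym2 V → unitInterval) (x y z : V) (N : Set V)
    (hxy : x ≠ y) (hxz : x ≠ z) (hyz : y ≠ z)
    (hE1 : 0 < (prodBernoulli w).real ({ω : BondConfig V | ¬ (openGraph ω).Reachable x y} ∩
      {ω | ¬ (openGraph ω).Reachable x z}))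
    (hE2 : 0 < (prodBernoulli w).real ({ω : BondConfig V | ¬ (openGraph ω).Reachable y x} ∩
      {ω | ¬ (openGraph ω).Reachable y z}))
    (hMDLx : ∀ G : Set V → ℝ, (∀ S T : Set V, S ⊆ T → G S ≤ G T) →
      (prodBernoulli w).real ({ω : BondConfig V | ∃ n ∈ N, (openGraph ω).Reachable y n} ∩
            ({ω | ∀ n ∈ N, ¬ (openGraph ω).Reachable x n} ∩ {ω | ∀ n ∈ N, ¬ (openGraph ω).Reachable z n})) *
        ((prodBernoulli w).real {ω : BondConfig V | ¬ (openGraph ω).Reachable x z} *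
            (∫ ω in openConn x y ∩ {ω | ¬ (openGraph ω).Reachable x z}, G (openCluster ω x) ∂(prodBernoulli w)) -
          (prodBernoulli w).real (openConn x y ∩ {ω | ¬ (openGraph ω).Reachable x z}) *
            ∫ ω in {ω : BondConfig V | ¬ (openGraph ω).Reachable x z}, G (openCluster ω x) ∂(prodBernoulli w)) ≤
      (prodBernoulli w).real ({ω : BondConfig V | ¬ (openGraph ω).Reachable y x} ∩
          {ω | ¬ (openGraph ω).Reachable y z}) *
        ((prodBernoulli w).real {ω : BondConfig V | ¬ (openGraph ω).Reachable x z} *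
            (∫ ω in {ω : BondConfig V | ∃ n ∈ N, (openGraph ω).Reachable x n} ∩
              {ω | ∀ n ∈ N, ¬ (openGraph ω).Reachable z n}, G (openCluster ω x) ∂(prodBernoulli w)) -
          (prodBernoulli w).real ({ω : BondConfig V | ∃ n ∈ N, (openGraph ω).Reachable x n} ∩
              {ω | ∀ n ∈ N, ¬ (openGraph ω).Reachable z n}) *
            ∫ ω in {ω : BondConfig V | ¬ (openGraph ω).Reachable x z}, G (openCluster ω x) ∂(prodBernoulli w)))
    (hMDLy : ∀ G : Set V → ℝ, (∀ S T : Set V, S ⊆ T → G S ≤ G T) →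
      (prodBernoulli w).real ({ω : BondConfig V | ∃ n ∈ N, (openGraph ω).Reachable x n} ∩
            ({ω | ∀ n ∈ N, ¬ (openGraph ω).Reachable y n} ∩ {ω | ∀ n ∈ N, ¬ (openGraph ω).Reachable z n})) *
        ((prodBernoulli w).real {ω : BondConfig V | ¬ (openGraph ω).Reachable y z} *
            (∫ ω in openConn y x ∩ {ω | ¬ (openGraph ω).Reachable y z}, G (openCluster ω y) ∂(prodBernoulli w)) -
          (prodBernoulli w).real (openConn y x ∩ {ω | ¬ (openGraph ω).Reachable y z}) *
            ∫ ω in {ω : BondConfig V | ¬ (openGraph ω).Reachable y z}, G (openCluster ω y) ∂(prodBernoulli w)) ≤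
      (prodBernoulli w).real ({ω : BondConfig V | ¬ (openGraph ω).Reachable x y} ∩
          {ω | ¬ (openGraph ω).Reachable x z}) *
        ((prodBernoulli w).real {ω : BondConfig V | ¬ (openGraph ω).Reachable y z} *
            (∫ ω in {ω : BondConfig V | ∃ n ∈ N, (openGraph ω).Reachable y n} ∩
              {ω | ∀ n ∈ N, ¬ (openGraph ω).Reachable z n}, G (openCluster ω y) ∂(prodBernoulli w)) -
          (prodBernoulli w).real ({ω : BondConfig V | ∃ n ∈ N, (openGraph ω).Reachable y n} ∩
              {ω | ∀ n ∈ N, ¬ (openGraph ω).Reachable z n}) *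
            ∫ ω in {ω : BondConfig V | ¬ (openGraph ω).Reachable y z}, G (openCluster ω y) ∂(prodBernoulli w)))
    (F : Set V → ℝ) (hF : ∀ S T : Set V, S ⊆ T → F S ≤ F T)
    (hDx : ∫ ω, F (openCluster ω z) ∂(prodBernoulli w) ≤ ∫ ω, F (openCluster ω x) ∂(prodBernoulli w))
    (hDy : ∫ ω, F (openCluster ω z) ∂(prodBernoulli w) ≤ ∫ ω, F (openCluster ω y) ∂(prodBernoulli w)) :
    ∫ ω in {ω : BondConfig V | ∃ n ∈ N, (openGraph ω).Reachable x n} ∪ {ω | ∃ n ∈ N, (openGraph ω).Reachable y n},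
        F (openCluster ω z) ∂(prodBernoulli w) ≤
      ∫ ω in {ω : BondConfig V | ∃ n ∈ N, (openGraph ω).Reachable x n} ∪ {ω | ∃ n ∈ N, (openGraph ω).Reachable y n},
        F (⋃ n ∈ N, openCluster ω n) ∂(prodBernoulli w) := by
  classical
  set μ := prodBernoulli w with hμ
  -- masses
  set E1 : Set (BondConfig V) := {ω : BondConfig V | ¬ (openGraph ω).Reachable x y} ∩
    {ω | ¬ (openGraph ω).Reachable x z} with hE1def
  set E2 : Set (BondConfig V) := {ω : BondConfig V | ¬ (openGraph ω).Reachable y x} ∩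
    {ω | ¬ (openGraph ω).Reachable y z} with hE2def
  set Ox : Set (BondConfig V) := {ω : BondConfig V | ∃ n ∈ N, (openGraph ω).Reachable x n} with hOx
  set Oy : Set (BondConfig V) := {ω : BondConfig V | ∃ n ∈ N, (openGraph ω).Reachable y n} with hOy
  set Ex : Set (BondConfig V) := {ω | ∀ n ∈ N, ¬ (openGraph ω).Reachable x n} with hEx
  set Ey : Set (BondConfig V) := {ω | ∀ n ∈ N, ¬ (openGraph ω).Reachable y n} with hEy
  set Ez : Set (BondConfig V) := {ω | ∀ n ∈ N, ¬ (openGraph ω).Reachable z n} with hEz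
  set Dxz : Set (BondConfig V) := {ω : BondConfig V | ¬ (openGraph ω).Reachable x z} with hDxz
  set Dyz : Set (BondConfig V) := {ω : BondConfig V | ¬ (openGraph ω).Reachable y z} with hDyz
  set a : ℝ := μ.real (Ox ∩ (Ey ∩ Ez)) with ha
  set b : ℝ := μ.real (Oy ∩ (Ex ∩ Ez)) with hb
  set ox : ℝ := μ.real (Ox ∩ Ez) with hox
  set oy : ℝ := μ.real (Oy ∩ Ez) with hoy
  set e1 : ℝ := μ.real E1 with he1
  set e2 : ℝ := μ.real E2 with he2
  change 0 < e1 at hE1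
  change 0 < e2 at hE2
  have ha0 : 0 ≤ a := measureReal_nonneg
  have hb0 : 0 ≤ b := measureReal_nonneg
  -- the split `t*` and the multipliers
  set s : ℝ := a * e2 + b * e1 with hs
  have hs0 : 0 ≤ s := by positivity
  set t : ℝ := if s = 0 then 0 else a * e2 / s with htdef
  have ht0 : 0 ≤ t := by
    simp only [htdef]; split_ifs
    · exact le_rfl
    · exact div_nonneg (by positivity) hs0
  have ht1 : t ≤ 1 := by
    simp only [htdef]; split_ifs with h
    · exact zero_le_one
    · rw [div_le_one (lt_of_le_of_ne hs0 (Ne.symm h))]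
      have : 0 ≤ b * e1 := by positivity
      linarith
  have htx : t * (a * e2 + b * e1) = a * e2 := by
    simp only [htdef]; split_ifs with h
    · -- `s = 0` forces `a = b = 0`
      have hae : a * e2 = 0 := by
        have h1 : 0 ≤ a * e2 := by positivity
        have h2 : 0 ≤ b * e1 := by positivity
        have h3 : a * e2 + b * e1 = 0 := h
        linarith
      rw [hae, zero_mul]
    · rw [← hs]; field_simp
  have hty : (1 - t) * (b * e1 + a * e2) = b * e1 := by
    have : (1 - t) * (b * e1 + a * e2) = (a * e2 + b * e1) - t * (a * e2 + b * e1) := by ring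
    rw [this, htx]; ring
  have hAx : 0 < μ.real Dxz := lt_of_lt_of_le hE1 (measureReal_mono inter_subset_right)
  have hAy : 0 < μ.real Dyz := lt_of_lt_of_le hE2 (measureReal_mono inter_subset_right)
  set lam : ℝ := ((1 - t) * a + t * ox) / μ.real Dxz with hlamdef
  set mu : ℝ := ((1 - (1 - t)) * b + (1 - t) * oy) / μ.real Dyz with hmudef
  have hlam : lam * μ.real Dxz = (1 - t) * a + t * ox := by
    rw [hlamdef]; field_simp
  have hmu : mu * μ.real Dyz = (1 - (1 - t)) * b + (1 - t) * oy := by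
    rw [hmudef]; field_simp
  have hox0 : 0 ≤ ox := measureReal_nonneg
  have hoy0 : 0 ≤ oy := measureReal_nonneg
  have hlam0 : 0 ≤ lam := by
    rw [hlamdef]; refine div_nonneg ?_ hAx.le
    have : 0 ≤ 1 - t := sub_nonneg.2 ht1
    positivity
  have hmu0 : 0 ≤ mu := by
    rw [hmudef]; refine div_nonneg ?_ hAy.le
    have h1 : (1 - (1 - t)) = t := by ring
    rw [h1]
    have : 0 ≤ 1 - t := sub_nonneg.2 ht1
    positivity
  -- the two observer halves, for every monotone `G`
  have hHx : ∀ G : Set V → ℝ, (∀ S T : Set V, S ⊆ T → G S ≤ G T) →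
      lam * ∫ ω in Dxz, G (openCluster ω x) ∂μ ≤
        (1 - t) * ∫ ω in Ox ∩ (Ey ∩ Ez), G (openCluster ω x) ∂μ + t * ∫ ω in Ox ∩ Ez, G (openCluster ω x) ∂μ :=
    fun G hG => hx_set_of_setMDL w x y z N hxy hxz G hG t lam ht0 ht1 hE1 hE2 htx hlam (hMDLx G hG)
  have hHy : ∀ G : Set V → ℝ, (∀ S T : Set V, S ⊆ T → G S ≤ G T) →
      mu * ∫ ω in Dyz, G (openCluster ω y) ∂μ ≤
        t * ∫ ω in Oy ∩ (Ex ∩ Ez), G (openCluster ω y) ∂μ + (1 - t) * ∫ ω in Oy ∩ Ez, G (openCluster ω y) ∂μ := by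
    intro G hG
    have h := hx_set_of_setMDL w y x z N (Ne.symm hxy) hyz G hG (1 - t) mu (sub_nonneg.2 ht1) (by linarith)
      hE2 hE1 hty hmu (hMDLy G hG)
    rw [show (1 - (1 - t)) = t by ring] at h
    exact h
  -- shift `F` to a nonnegative monotone function and conclude with the bookkeeping theorem
  set F0 : Set V → ℝ := fun S => F S - F ∅ with hF0def
  have hF0m : ∀ S T : Set V, S ⊆ T → F0 S ≤ F0 T := fun S T h => sub_le_sub_right (hF S T h) _
  have hF0nn : ∀ S, 0 ≤ F0 S := fun S => sub_nonneg.2 (hF ∅ S (empty_subset S))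
  have hshift : ∀ (g : BondConfig V → Set V) (S : Set (BondConfig V)),
      ∫ ω in S, F0 (g ω) ∂μ = (∫ ω in S, F (g ω) ∂μ) - μ.real S * F ∅ := by
    intro g S
    simp only [hF0def]
    rw [integral_sub (Integrable.of_finite) (Integrable.of_finite), setIntegral_const, smul_eq_mul]
  have hshift' : ∀ (g : BondConfig V → Set V), ∫ ω, F0 (g ω) ∂μ = (∫ ω, F (g ω) ∂μ) - F ∅ := by
    intro g
    simp only [hF0def]
    rw [integral_sub (Integrable.of_finite) (Integrable.of_finite), integral_const, smul_eq_mul, probReal_univ,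
      one_mul]
  have hDx0 : ∫ ω, F0 (openCluster ω z) ∂μ ≤ ∫ ω, F0 (openCluster ω x) ∂μ := by
    rw [hshift' (fun ω => openCluster ω z), hshift' (fun ω => openCluster ω x)]; linarith
  have hDy0 : ∫ ω, F0 (openCluster ω z) ∂μ ≤ ∫ ω, F0 (openCluster ω y) ∂μ := by
    rw [hshift' (fun ω => openCluster ω z), hshift' (fun ω => openCluster ω y)]; linarith
  have key := gpsi_three_set_of_halves w x y z N F0 hF0m hF0nn t lam mu ht0 ht1 hlam0 hmu0 hHx hHy hDx0 hDy0
  rw [hshift (fun ω => openCluster ω z), hshift (fun ω => ⋃ n ∈ N, openCluster ω n)] at key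
  linarith

end Q7Psi

end

end Summit.CriticalPhenomena.PercolationContinuityZ3.Theorems
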